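import Mathlib
import Summits.ValiantsHypothesis.ValiantsHypothesis.Theses.DivisionGap
import Literature.Computability.AlgebraicComplexity.ArithCircuitProofs

/-!
# `DivisionGap.PerMultiplesHard` (stmt-ValiantsHypothesis-5068): top forms are free for monotone
circuits, so counterexample multipliers may be assumed multihomogeneous — negative knowledge from
the standing disprover

Over the semiring `ℝ≥0` a circuit has no cancellations: the top `w`-homogeneous component ("leading
form", `topForm w`) of a sum is the sum of the top forms of the summands of maximal degree, and — as
`ℝ≥0[x]` has no zero divisors — the top form of a product is the product of the top forms.  Hence
replacing every gate of a monotone circuit by its top form gives a monotone circuit of the SAME size: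

* `complexity_topForm_le` — **`L⁺(topForm_w f) ≤ L⁺(f)`** for every weight `w : σ → ℕ` (the tree's
  fan-in-two `complexity` over `ℝ≥0`; explicit gate-by-gate transformation `newGate`,
  `exists_gates_topForm`).  A reusable structural fact about monotone computation (Jerrum–Snir 1982
  §2 use its homogeneous special case).
* `topForm_mul`, `topForm_list_sum`, `topForm_list_prod`, `topForm_smul` — the algebra of top forms
  over `ℝ≥0`.
* The permanent-specific consequences (WLOG multihomogeneous multipliers, faces of the Birkhoff polytope)
  are in the companion `Negative/TopFormsPermanent.lean`.

No statement here asserts or refutes a route item; all are tools and normal forms.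
-/

noncomputable section

namespace Summit.ValiantsHypothesis.Theorems.PerMultiplesHardNegative

open MvPolynomial
open Finsupp (weight)
open scoped NNReal

variable {σ : Type*} (w : σ → ℕ)

/-- The top `w`-homogeneous component ("leading form") of a polynomial over `ℝ≥0`. [folklore] -/
def topForm (p : MvPolynomial σ ℝ≥0) : MvPolynomial σ ℝ≥0 :=
  weightedHomogeneousComponent w (weightedTotalDegree w p) p

/-- Coefficients of the top form: those of top weighted degree, else `0`. [folklore] -/
theorem coeff_topForm [DecidableEq ℕ] (p : MvPolynomial σ ℝ≥0) (d : σ →₀ ℕ) :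
    coeff d (topForm w p) = if weight w d = weightedTotalDegree w p then coeff d p else 0 := by
  classical
  unfold topForm
  convert coeff_weightedHomogeneousComponent (weightedTotalDegree w p) p d

/-- The top form of `0` is `0`. [folklore] -/
@[simp] theorem topForm_zero : topForm w (0 : MvPolynomial σ ℝ≥0) = 0 := by
  simp [topForm]

/-- The top form is weighted homogeneous of the top degree. [folklore] -/
theorem isWeightedHomogeneous_topForm (p : MvPolynomial σ ℝ≥0) :
    IsWeightedHomogeneous w (topForm w p) (weightedTotalDegree w p) :=
  weightedHomogeneousComponent_isWeightedHomogeneous _ _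

/-- A nonzero polynomial has a monomial of top weighted degree. [folklore] -/
theorem exists_weight_eq {p : MvPolynomial σ ℝ≥0} (hp : p ≠ 0) :
    ∃ d ∈ p.support, weight w d = weightedTotalDegree w p := by
  obtain ⟨d, hd, h⟩ := Finset.exists_mem_eq_sup p.support (support_nonempty.mpr hp) (fun s => weight w s)
  exact ⟨d, hd, h.symm⟩

/-- The top form of a nonzero polynomial is nonzero. [folklore] -/
theorem topForm_ne_zero {p : MvPolynomial σ ℝ≥0} (hp : p ≠ 0) : topForm w p ≠ 0 := by
  classical
  obtain ⟨d, hd, hdeg⟩ := exists_weight_eq w hp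
  intro h0
  have h := congrArg (coeff d) h0
  rw [coeff_topForm, if_pos hdeg, coeff_zero] at h
  exact (MvPolynomial.mem_support_iff.1 hd) h

/-- A weighted homogeneous polynomial is its own top form. [folklore] -/
theorem topForm_of_isWeightedHomogeneous {p : MvPolynomial σ ℝ≥0} {m : ℕ}
    (hp : IsWeightedHomogeneous w p m) : topForm w p = p := by
  by_cases h0 : p = 0
  · rw [h0, topForm_zero]
  · have hdeg : weightedTotalDegree w p = m := by
      have h := hp.weighted_total_degree h0
      rw [weightedTotalDegree_coe w p h0] at h
      exact_mod_cast h
    rw [topForm, hdeg]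
    exact hp.weightedHomogeneousComponent_same

/-- Variables are their own top forms. [folklore] -/
@[simp] theorem topForm_X (i : σ) : topForm w (X i : MvPolynomial σ ℝ≥0) = X i :=
  topForm_of_isWeightedHomogeneous w (isWeightedHomogeneous_X ℝ≥0 w i)

/-- Constants are their own top forms. [folklore] -/
@[simp] theorem topForm_C (c : ℝ≥0) : topForm w (C c : MvPolynomial σ ℝ≥0) = C c :=
  topForm_of_isWeightedHomogeneous w (isWeightedHomogeneous_C w c)

/-- `1` is its own top form. [folklore] -/
@[simp] theorem topForm_one : topForm w (1 : MvPolynomial σ ℝ≥0) = 1 :=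
  topForm_of_isWeightedHomogeneous w (isWeightedHomogeneous_one ℝ≥0 w)

/-! No cancellation over `ℝ≥0`. -/

/-- Coefficients of a list sum. [folklore] -/
theorem coeff_list_sum (d : σ →₀ ℕ) (ts : List (MvPolynomial σ ℝ≥0)) :
    coeff d ts.sum = (ts.map fun t => coeff d t).sum := by
  induction ts with
  | nil => simp
  | cons t ts ih => rw [List.sum_cons, coeff_add, List.map_cons, List.sum_cons, ih]

/-- No cancellation over `ℝ≥0`: the support of a summand lies in the support of the sum. [folklore] -/
theorem support_subset_of_mem_list {ts : List (MvPolynomial σ ℝ≥0)} {t : MvPolynomial σ ℝ≥0}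
    (ht : t ∈ ts) : t.support ⊆ ts.sum.support := by
  intro d hd
  rw [MvPolynomial.mem_support_iff] at hd ⊢
  have hle : coeff d t ≤ coeff d ts.sum := by
    rw [coeff_list_sum]
    exact List.le_sum_of_mem (List.mem_map.2 ⟨t, ht, rfl⟩)
  exact fun h0 => hd (nonpos_iff_eq_zero.1 (h0 ▸ hle))

/-- Weighted total degree is monotone in the support. [folklore] -/
theorem weightedTotalDegree_mono {p q : MvPolynomial σ ℝ≥0} (h : p.support ⊆ q.support) :
    weightedTotalDegree w p ≤ weightedTotalDegree w q :=
  Finset.sup_mono h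

/-- No monomial lies above the weighted total degree. [folklore] -/
theorem coeff_eq_zero_of_lt {p : MvPolynomial σ ℝ≥0} {d : σ →₀ ℕ}
    (h : weightedTotalDegree w p < weight w d) : coeff d p = 0 := by
  by_contra hne
  exact absurd (le_weightedTotalDegree w (MvPolynomial.mem_support_iff.2 hne)) (not_le.2 h)

/-- **Top forms of sums over `ℝ≥0`:** the top form of a (list) sum is the sum of the top forms of
those summands whose degree attains the degree of the sum. [folklore] -/
theorem topForm_list_sum (ts : List (MvPolynomial σ ℝ≥0)) :
    topForm w ts.sum =
      (ts.map fun t => if weightedTotalDegree w t = weightedTotalDegree w ts.sum then topForm w t else 0).sum := by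
  classical
  refine MvPolynomial.ext _ _ fun d => ?_
  rw [coeff_topForm, coeff_list_sum d (List.map _ ts), List.map_map]
  by_cases hd : weight w d = weightedTotalDegree w ts.sum
  · rw [if_pos hd, coeff_list_sum]
    congr 1
    apply List.map_congr_left
    intro t ht
    simp only [Function.comp_apply]
    by_cases hdeg : weightedTotalDegree w t = weightedTotalDegree w ts.sum
    · rw [if_pos hdeg, coeff_topForm, if_pos (hd.trans hdeg.symm)]
    · rw [if_neg hdeg, coeff_zero]
      apply coeff_eq_zero_of_lt w
      have hle := weightedTotalDegree_mono w (support_subset_of_mem_list ht)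
      omega
  · rw [if_neg hd]
    symm
    apply List.sum_eq_zero
    intro x hx
    obtain ⟨t, -, rfl⟩ := List.mem_map.1 hx
    simp only [Function.comp_apply]
    split_ifs with hdeg
    · rw [coeff_topForm, if_neg (hdeg ▸ hd)]
    · rfl

/-- **Top forms of products over `ℝ≥0`** (no zero divisors): multiplicative. [folklore] -/
theorem topForm_mul (p q : MvPolynomial σ ℝ≥0) : topForm w (p * q) = topForm w p * topForm w q := by
  classical
  by_cases hp : p = 0
  · simp [hp]
  by_cases hq : q = 0
  · simp [hq]
  set a := weightedTotalDegree w p with ha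
  set b := weightedTotalDegree w q with hb
  -- (1) every monomial of `p * q` has weight `≤ a + b`
  have hle : ∀ d ∈ (p * q).support, weight w d ≤ a + b := by
    intro d hd
    obtain ⟨e, he, f, hf, rfl⟩ := Finset.mem_add.1 (support_mul p q hd)
    rw [map_add]
    exact add_le_add (le_weightedTotalDegree w he) (le_weightedTotalDegree w hf)
  -- (2) on weight `a + b` the coefficients of `p * q` and `Tp * Tq` agree
  have hcoeff : ∀ d, weight w d = a + b → coeff d (p * q) = coeff d (topForm w p * topForm w q) := by
    intro d hd
    rw [coeff_mul, coeff_mul]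
    apply Finset.sum_congr rfl
    intro x hx
    rw [Finset.HasAntidiagonal.mem_antidiagonal] at hx
    rw [coeff_topForm, coeff_topForm]
    by_cases he : weight w x.1 = a
    · by_cases hf : weight w x.2 = b
      · rw [if_pos he, if_pos hf]
      · -- weight x.2 ≠ b: then coeff x.2 q = 0 unless weight < b, but weights must add up
        rw [if_pos he, if_neg hf, mul_zero]
        by_cases hq0 : coeff x.2 q = 0
        · rw [hq0, mul_zero]
        · exfalso
          have h2 := le_weightedTotalDegree w (MvPolynomial.mem_support_iff.2 hq0)
          have hsum : weight w x.1 + weight w x.2 = a + b := by rw [← map_add, hx, hd]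
          omega
    · rw [if_neg he, zero_mul]
      by_cases hp0 : coeff x.1 p = 0
      · rw [hp0, zero_mul]
      · by_cases hq0 : coeff x.2 q = 0
        · rw [hq0, mul_zero]
        · exfalso
          have h1 := le_weightedTotalDegree w (MvPolynomial.mem_support_iff.2 hp0)
          have h2 := le_weightedTotalDegree w (MvPolynomial.mem_support_iff.2 hq0)
          have hsum : weight w x.1 + weight w x.2 = a + b := by rw [← map_add, hx, hd]
          omega
  -- (3) `Tp * Tq` is nonzero and homogeneous of weight `a + b`, so `wdeg (p q) = a + b`
  have hhom : IsWeightedHomogeneous w (topForm w p * topForm w q) (a + b) :=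
    (isWeightedHomogeneous_topForm w p).mul (isWeightedHomogeneous_topForm w q)
  have hne : topForm w p * topForm w q ≠ 0 := mul_ne_zero (topForm_ne_zero w hp) (topForm_ne_zero w hq)
  have hdeg : weightedTotalDegree w (p * q) = a + b := by
    apply le_antisymm (Finset.sup_le hle)
    obtain ⟨d, hd⟩ := exists_coeff_ne_zero hne
    have hwd : weight w d = a + b := hhom hd
    rw [← hcoeff d hwd] at hd
    exact hwd ▸ le_weightedTotalDegree w (MvPolynomial.mem_support_iff.2 hd)
  -- (4) conclude coefficientwise
  refine MvPolynomial.ext _ _ fun d => ?_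
  rw [coeff_topForm, hdeg]
  split_ifs with hwd
  · exact hcoeff d hwd
  · exact (hhom.coeff_eq_zero d hwd).symm

/-- Top forms of list products over `ℝ≥0`: multiplicative. [folklore] -/
theorem topForm_list_prod (ts : List (MvPolynomial σ ℝ≥0)) :
    topForm w ts.prod = (ts.map (topForm w)).prod := by
  induction ts with
  | nil => simp
  | cons t ts ih => rw [List.prod_cons, List.map_cons, List.prod_cons, topForm_mul, ih]

/-- Top forms commute with scalars over `ℝ≥0`. [folklore] -/
theorem topForm_smul (c : ℝ≥0) (p : MvPolynomial σ ℝ≥0) : topForm w (c • p) = c • topForm w p := by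
  classical
  by_cases hc : c = 0
  · simp [hc]
  have hsupp : (c • p).support = p.support := by
    ext d
    simp [MvPolynomial.mem_support_iff, hc]
  refine MvPolynomial.ext _ _ fun d => ?_
  rw [coeff_topForm, coeff_smul, coeff_smul, coeff_topForm]
  unfold weightedTotalDegree
  rw [hsupp]
  split_ifs <;> simp


/-! ### Homogeneity is inherited by top forms -/

/-- Weighted homogeneity for any other weight is inherited by top forms (the support shrinks). [folklore] -/
theorem IsWeightedHomogeneous.topForm_of {w' : σ → ℕ} {p : MvPolynomial σ ℝ≥0} {m : ℕ}
    (hp : IsWeightedHomogeneous w' p m) : IsWeightedHomogeneous w' (topForm w p) m := by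
  classical
  intro d hd
  rw [coeff_topForm] at hd
  split_ifs at hd with h
  · exact hp hd
  · exact absurd rfl hd

/-! ### The circuit transformation: every gate replaced by its top form -/

open Literature.Computability.AlgebraicComplexity ArithCircuit

/-- Operands commute with top forms (inputs and constants are homogeneous; junk reads `0`). [folklore] -/
theorem Operand.eval_topForm (vals : List (MvPolynomial σ ℝ≥0)) (u : Operand ℝ≥0 σ) :
    u.eval (vals.map (topForm w)) = topForm w (u.eval vals) := by
  cases u with
  | var i => simp [Operand.eval]
  | const c => simp [Operand.eval]
  | gate j =>
    simp only [Operand.eval, List.getD_eq_getElem?_getD, List.getElem?_map]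
    cases vals[j]? <;> simp

/-- The replacement gate: product gates are kept; in a sum gate the coefficients of the summands
whose degree does not attain the degree of the sum are set to `0`. [folklore] -/
def newGate (vals : List (MvPolynomial σ ℝ≥0)) : Gate ℝ≥0 σ → Gate ℝ≥0 σ
  | .prod args => .prod args
  | .sum args => .sum (args.map fun a =>
      (if weightedTotalDegree w (a.1 • a.2.eval vals) =
          weightedTotalDegree w ((Gate.sum args).eval vals) then a.1 else 0, a.2))

/-- The replacement gate has the same fan-in. [folklore] -/
theorem fanIn_newGate (vals : List (MvPolynomial σ ℝ≥0)) (g : Gate ℝ≥0 σ) :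
    (newGate w vals g).fanIn = g.fanIn := by
  cases g <;> simp [newGate, Gate.fanIn, Gate.args]

/-- The replacement gate computes the top form of the old gate value, given the top forms of the earlier values. [folklore] -/
theorem eval_newGate (vals : List (MvPolynomial σ ℝ≥0)) (g : Gate ℝ≥0 σ) :
    (newGate w vals g).eval (vals.map (topForm w)) = topForm w (g.eval vals) := by
  cases g with
  | sum args =>
    simp only [newGate, Gate.eval, List.map_map]
    rw [topForm_list_sum, List.map_map]
    congr 1
    apply List.map_congr_left
    intro a _
    simp only [Function.comp_apply, Operand.eval_topForm]
    split_ifs with h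
    · rw [topForm_smul]
    · rw [zero_smul]
  | prod args =>
    simp only [newGate, Gate.eval]
    rw [topForm_list_prod, List.map_map]
    congr 1
    apply List.map_congr_left
    intro u _
    simp only [Function.comp_apply, Operand.eval_topForm]

/-- Gate lists: same length, same fan-in bound, values replaced by their top forms. [folklore] -/
theorem exists_gates_topForm (gs : List (Gate ℝ≥0 σ)) (h2 : ∀ g ∈ gs, g.fanIn ≤ 2) :
    ∃ gs' : List (Gate ℝ≥0 σ), gs'.length = gs.length ∧ (∀ g ∈ gs', g.fanIn ≤ 2) ∧
      gateValues gs' = (gateValues gs).map (topForm w) := by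
  induction gs using List.reverseRecOn with
  | nil => exact ⟨[], rfl, fun g hg => by simp at hg, by simp [gateValues]⟩
  | append_singleton gs g ih =>
    obtain ⟨gs', hlen, hfan, hval⟩ := ih (fun g' hg' => h2 g' (List.mem_append_left _ hg'))
    refine ⟨gs' ++ [newGate w (gateValues gs) g], by simp [hlen], ?_, ?_⟩
    · intro g' hg'
      rw [List.mem_append, List.mem_singleton] at hg'
      rcases hg' with h | rfl
      · exact hfan g' h
      · rw [fanIn_newGate]
        exact h2 g (List.mem_append_right _ (List.mem_singleton_self g))
    · rw [gateValues_append_singleton, gateValues_append_singleton, hval, List.map_append,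
        List.map_singleton, eval_newGate]

/-- **Top forms are free for monotone circuits**: `L⁺(topForm_w f) ≤ L⁺(f)` over `ℝ≥0`, for every
weight `w` (no cancellation in sums, no zero divisors in products). [folklore] -/
theorem complexity_topForm_le (f : MvPolynomial σ ℝ≥0) : complexity (topForm w f) ≤ complexity f := by
  obtain ⟨P, h2, hf, hs⟩ := ArithCircuit.exists_computes_size_eq_complexity f
  obtain ⟨gs', hlen, hfan, hval⟩ := exists_gates_topForm w P.gates h2
  let Q : ArithCircuit ℝ≥0 σ := ⟨gs', P.output⟩
  have hQ2 : Q.IsFanInTwo := hfan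
  have hQf : Q.Computes (topForm w f) := by
    unfold ArithCircuit.Computes at hf ⊢
    change P.output.eval (gateValues gs') = topForm w f
    rw [hval, Operand.eval_topForm, ← hf]
    rfl
  calc complexity (topForm w f) ≤ Q.size := ArithCircuit.complexity_le_size hQ2 hQf
    _ = P.size := hlen
    _ = complexity f := hs

/-! ### Iterated top forms -/

/-- Iterate top forms over a list of weights (right fold: the head weight is applied last). [folklore] -/
def multiTop (ws : List (σ → ℕ)) (h : MvPolynomial σ ℝ≥0) : MvPolynomial σ ℝ≥0 :=
  ws.foldr (fun w' acc => topForm w' acc) h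

/-- No weights: `multiTop [] h = h`. [folklore] -/
@[simp] theorem multiTop_nil (h : MvPolynomial σ ℝ≥0) : multiTop [] h = h := rfl

/-- One more weight: `multiTop (w :: ws) h = topForm w (multiTop ws h)`. [folklore] -/
@[simp] theorem multiTop_cons (w' : σ → ℕ) (ws : List (σ → ℕ)) (h : MvPolynomial σ ℝ≥0) :
    multiTop (w' :: ws) h = topForm w' (multiTop ws h) := rfl

/-- Iterated top forms of a nonzero polynomial are nonzero. [folklore] -/
theorem multiTop_ne_zero (ws : List (σ → ℕ)) {h : MvPolynomial σ ℝ≥0} (hh : h ≠ 0) :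
    multiTop ws h ≠ 0 := by
  induction ws with
  | nil => exact hh
  | cons w' ws ih => rw [multiTop_cons]; exact topForm_ne_zero w' ih

/-- `multiTop ws h` is homogeneous for every weight in `ws`. [folklore] -/
theorem isWeightedHomogeneous_multiTop (ws : List (σ → ℕ)) (h : MvPolynomial σ ℝ≥0)
    {w' : σ → ℕ} (hw : w' ∈ ws) : ∃ m, IsWeightedHomogeneous w' (multiTop ws h) m := by
  induction ws with
  | nil => simp at hw
  | cons w₀ ws ih =>
    rw [multiTop_cons]
    rw [List.mem_cons] at hw
    rcases hw with rfl | hw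
    · exact ⟨_, isWeightedHomogeneous_topForm w' _⟩
    · obtain ⟨m, hm⟩ := ih hw
      exact ⟨m, IsWeightedHomogeneous.topForm_of w₀ hm⟩

/-- `L⁺(multiTop ws h) ≤ L⁺(h)`. [folklore] -/
theorem complexity_multiTop_le (ws : List (σ → ℕ)) (h : MvPolynomial σ ℝ≥0) :
    complexity (multiTop ws h) ≤ complexity h := by
  induction ws with
  | nil => exact le_rfl
  | cons w₀ ws ih => rw [multiTop_cons]; exact (complexity_topForm_le w₀ _).trans ih

/-- Multiplying by a polynomial `f` that is homogeneous for every weight in the list commutes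
with `multiTop`, and costs nothing: `L⁺(f · multiTop ws h) ≤ L⁺(f · h)`. [folklore] -/
theorem complexity_mul_multiTop_le (ws : List (σ → ℕ)) (f h : MvPolynomial σ ℝ≥0)
    (hf : ∀ w' ∈ ws, ∃ m, IsWeightedHomogeneous w' f m) :
    complexity (f * multiTop ws h) ≤ complexity (f * h) := by
  induction ws with
  | nil => exact le_rfl
  | cons w₀ ws ih =>
    have hf' : ∀ w' ∈ ws, ∃ m, IsWeightedHomogeneous w' f m :=
      fun w' hw' => hf w' (List.mem_cons_of_mem _ hw')
    obtain ⟨m, hm⟩ := hf w₀ (List.mem_cons_self)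
    rw [multiTop_cons]
    have key : f * topForm w₀ (multiTop ws h) = topForm w₀ (f * multiTop ws h) := by
      rw [topForm_mul, topForm_of_isWeightedHomogeneous w₀ hm]
    rw [key]
    exact (complexity_topForm_le w₀ _).trans (ih hf')

end Summit.ValiantsHypothesis.Theorems.PerMultiplesHardNegative

end
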